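import Mathlib
import Summits.ResolutionOfSingularities.ResolutionOfSingularities.Theorems.WeightedInvariantLocalWeightedDropMonicDescentStrategy
import Summits.ResolutionOfSingularities.ResolutionOfSingularities.Theorems.WeightedInvariantLocalWeightedDropMonicDescentChartSubst
import Summits.ResolutionOfSingularities.ResolutionOfSingularities.Theorems.WeightedInvariantLocalWeightedDropHyperbolicSplit
import Summits.ResolutionOfSingularities.ResolutionOfSingularities.Theorems.WeightedInvariantLocalWeightedDropMonicDescentTailTools
import Summits.ResolutionOfSingularities.ResolutionOfSingularities.Theorems.WeightedInvariantLocalWeightedDropSliceChart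
import Summits.ResolutionOfSingularities.ResolutionOfSingularities.Theorems.WeightedInvariantLocalWeightedDropMultiplicityLift

/-!
# `WeightedInvariant.LocalWeightedDrop`, sub-stub `stub_monicDoublePointDescends`, piece T-6′ (game bridge), part 1:
# RE-PRESENTATION OF A SLICE BY A LABEL from 2-variable data, and the slice data of the two moves

Crux item stmt-ResolutionOfSingularities-8899 `LocalWeightedDrop` (route `ResolutionOfSingularities/WeightedInvariant`), door
`HypersurfaceCentreConstruction` stmt-ResolutionOfSingularities-19897.  [OURS · L1 W4.3, chain w43, seat res-type-056 (T-6′ per SEAT TABLE v6);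
tools for the hypothesis hT6 of `MonicDescent.descends_of_pieces` (p488513).  Objects the engine line posits; nothing here is a statement
of any manuscript.]

* `subst_blowFamily_shear_C`, `X_pow_mul_blowOne_shear_C` — `u₁^c · blowOne c (shear (C λ) A) = A(u₁, u₁(u₂ + λ))`;
* `pos_eq_monicForm` — `pos A₀ A₁` in the `Σ_j`-spelling of the game clauses;
* `represents_pos_of_subst` — THE LIFT: if a substitution `τ` of `k[[u₁,u₂]]` (zero constant terms, invertible linear part) and a unit `u`
  satisfy `τ^* T₀ = u² X₀`, `τ^* T₁ = u X₁`, then `pos T₀ T₁` is formally re-presented (`Represents`) by `(X₀, X₁)` — via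
  `θ = (τ, u·y)`, `H = u²`; `represents_of_sliceData` — the same from the slice data `s²T₀ = F₀`, `sT₁ = F₁`;
* the RESTRICTED CHART FAMILIES of the two moves of the descent game after slicing (`restrictedChart_point_zero/one`,
  `restrictedChart_curve_zero/one`) and the SLICE DATA `pointSlice_data` / `curveSlice_data`: the slices `T_j = (s·Bv_j)|_{y′_{i₀}=0}` of the
  clauses `PointClause` / `CurveClause` (spelling of `won_monic_of_pointBlowup` / `won_monic_of_curveBlowup`) satisfy
  `s^{2−j} T_j = B_j ∘ (restricted chart)` (`SliceChart.subst_restrictedChart`).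
-/

set_option linter.dupNamespace false -- mandated namespace of this single-conjunct summit

noncomputable section

namespace Summit.ResolutionOfSingularities.ResolutionOfSingularities.Theorems

namespace MonicDescent

open MvPowerSeries Literature.RingTheory.TwoVariableSeries Literature.AlgebraicGeometry.Resolution

variable {k : Type} [Field k]

/-! ## `shear (C λ)` followed by the `u₁`-chart -/

/-- `(shear (C λ) A)(u₁, u₁u₂) = A(u₁, u₁(u₂ + λ))`: the `u₁`-chart of the label re-read in `ũ₂ = u₂ + λu₁` is the transform at the
exceptional point `(1 : λ)`. -/
theorem subst_blowFamily_shear_C (c : k) (A : MvPowerSeries (Fin 2) k) :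
    subst ![(X 0 : MvPowerSeries (Fin 2) k), X 0 * X 1] (shear (C c) A) =
      subst ![(X 0 : MvPowerSeries (Fin 2) k), X 0 * (X 1 + C c)] A := by
  have hσ : HasSubst ![(X 0 : MvPowerSeries (Fin 2) k), X 0 * X 1] := hasSubst_of_constantCoeff_zero constantCoeff_blowFamily
  have hτ : ∀ h : MvPowerSeries (Fin 2) k, HasSubst ![X 0, X 1 + X 0 * h] :=
    fun h => hasSubst_of_constantCoeff_zero (constantCoeff_shearFamily h)
  rw [shear_eq]
  refine (subst_comp_subst_apply (hτ (C c)) hσ A).trans ?_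
  congr 1
  funext i
  fin_cases i
  · show subst ![X 0, X 0 * X 1] (X 0) = X 0
    rw [subst_X hσ]
    rfl
  · show subst ![X 0, X 0 * X 1] (X 1 + X 0 * C c) = X 0 * (X 1 + C c)
    have hC : (X 0 : MvPowerSeries (Fin 2) k) * C c = c • X 0 := by rw [mul_comm, smul_eq_C_mul]
    rw [hC, ← coe_substAlgHom hσ, map_add, map_smul, substAlgHom_X, substAlgHom_X, smul_eq_C_mul]
    show X 0 * X 1 + C c * X 0 = X 0 * (X 1 + C c)
    ring

/-! ## `pos` in the `Σ_j`-spelling of the clauses -/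

/-- `pos A₀ A₁ = y² + Σ_{j<2} A_j y^j`. -/
theorem pos_eq_monicForm {m : ℕ} (A₀ A₁ : MvPowerSeries (Fin m) k) :
    pos A₀ A₁ = X (Fin.last m) ^ 2 + ∑ j : Fin 2, rename (Fin.succAboveEmb (Fin.last m)) ((![A₀, A₁] : Fin 2 → _) j) *
      X (Fin.last m) ^ (j : ℕ) := by
  rw [pos, Fin.sum_univ_two]
  simp only [Matrix.cons_val_zero, Matrix.cons_val_one, Fin.val_zero, Fin.val_one, pow_zero, mul_one, pow_one]

/-! ## The lift: re-presentation of `pos T` by a label from 2-variable data -/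

/-- The cylinder embedding `Fin 2 ↪ Fin 3` along the last slot is the obvious one. -/
theorem succAboveEmb_last_two_apply (i : Fin 2) : (Fin.succAboveEmb (Fin.last 2)) i = Fin.castSucc i := by
  rw [Fin.coe_succAboveEmb, Fin.succAbove_last]

/-- THE LIFT (OURS · L1 W4.3, piece T-6′).  If a substitution `τ` of `k[[u₁,u₂]]` with zero constant terms and invertible linear part and a
series `u` with `u(0) ≠ 0` satisfy `τ^* T₀ = u² · X₀` and `τ^* T₁ = u · X₁`, then `pos T₀ T₁` is formally re-presented by `(X₀, X₁)`:
`θ = (τ₀, τ₁, u·y)`, `H = u²`, `θ^* pos T = u²y² + u X₁ · u y + u² X₀ = H · pos X`. -/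
theorem represents_pos_of_subst {T₀ T₁ X₀ X₁ : MvPowerSeries (Fin 2) k} (τ : Fin 2 → MvPowerSeries (Fin 2) k)
    (u : MvPowerSeries (Fin 2) k) (hτ0 : ∀ i, constantCoeff (τ i) = 0) (hτdet : IsUnit (FormalCoordChange.linMat τ).det)
    (hu : constantCoeff u ≠ 0) (h₀ : subst τ T₀ = u ^ 2 * X₀) (h₁ : subst τ T₁ = u * X₁) :
    Represents (pos T₀ T₁) X₀ X₁ := by
  classical
  show ∃ (θ : Fin 3 → MvPowerSeries (Fin 3) k) (H : MvPowerSeries (Fin 3) k), (∀ i, constantCoeff (θ i) = 0) ∧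
    IsUnit (FormalCoordChange.linMat θ).det ∧ constantCoeff H ≠ 0 ∧ subst θ (pos T₀ T₁) = H * pos X₀ X₁
  -- the substitution θ = (τ, u·y)
  obtain ⟨θ, hθ⟩ : ∃ θ : Fin 3 → MvPowerSeries (Fin 3) k,
      ∀ l, θ l = if h : l = Fin.last 2 then rename (Fin.succAboveEmb (Fin.last 2)) u * X (Fin.last 2) else rename (Fin.succAboveEmb (Fin.last 2)) (τ (l.castPred h)) :=
    ⟨_, fun _ => rfl⟩
  have hθlast : θ (Fin.last 2) = rename (Fin.succAboveEmb (Fin.last 2)) u * X (Fin.last 2) := by rw [hθ, dif_pos rfl]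
  have hθcast : ∀ i : Fin 2, θ (Fin.castSucc i) = rename (Fin.succAboveEmb (Fin.last 2)) (τ i) := by
    intro i
    rw [hθ, dif_neg (Fin.castSucc_lt_last i).ne]
    simp
  have hθe : ∀ i : Fin 2, θ (Fin.succAboveEmb (Fin.last 2) i) = rename (Fin.succAboveEmb (Fin.last 2)) (τ i) := by
    intro i; rw [succAboveEmb_last_two_apply, hθcast]
  have hθ0 : ∀ l, constantCoeff (θ l) = 0 := by
    intro l
    rcases Fin.eq_castSucc_or_eq_last l with ⟨i, rfl⟩ | rfl
    · rw [hθcast, constantCoeff_rename, hτ0]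
    · rw [hθlast, map_mul, constantCoeff_X, mul_zero]
  have hθs : HasSubst θ := hasSubst_of_constantCoeff_zero hθ0
  -- θ on renamed series
  have hθren : ∀ T : MvPowerSeries (Fin 2) k, subst θ (rename (Fin.succAboveEmb (Fin.last 2)) T) = rename (Fin.succAboveEmb (Fin.last 2)) (subst τ T) := by
    intro T
    rw [subst_rename_eq (Fin.succAboveEmb (Fin.last 2)) θ hθ0 T, rename_subst_eq (Fin.succAboveEmb (Fin.last 2)) τ hτ0 T]
    congr 1
    funext i
    exact hθe i
  -- the linear matrix: block diagonal (linMat τ, u(0))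
  have hτentry : ∀ i j : Fin 2, FormalCoordChange.linMat θ (Fin.castSucc i) (Fin.castSucc j) = FormalCoordChange.linMat τ i j := by
    intro i j
    simp only [FormalCoordChange.linMat, Matrix.of_apply]
    rw [hθcast, ← succAboveEmb_last_two_apply j, ← Finsupp.embDomain_single, coeff_embDomain_rename]
  have hcol : ∀ i : Fin 2, FormalCoordChange.linMat θ (Fin.castSucc i) (Fin.last 2) = 0 := by
    intro i
    simp only [FormalCoordChange.linMat, Matrix.of_apply]
    rw [hθcast]
    have h := TschirnhausForm.coeff_emb_add_single_rename (m := 2) (0 : Fin 2 →₀ ℕ) 1 (τ i)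
    rw [Finsupp.embDomain_zero, zero_add, if_neg one_ne_zero] at h
    exact h
  have hrow : ∀ j : Fin 2, FormalCoordChange.linMat θ (Fin.last 2) (Fin.castSucc j) = 0 := by
    intro j
    simp only [FormalCoordChange.linMat, Matrix.of_apply]
    rw [hθlast, HyperbolicSplit.coeff_single_mul_X, if_neg (Fin.castSucc_lt_last j).ne]
  have hcorner : FormalCoordChange.linMat θ (Fin.last 2) (Fin.last 2) = constantCoeff u := by
    simp only [FormalCoordChange.linMat, Matrix.of_apply]
    rw [hθlast, HyperbolicSplit.coeff_single_mul_X, if_pos rfl, constantCoeff_rename]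
  have e00 : FormalCoordChange.linMat θ 0 0 = FormalCoordChange.linMat τ 0 0 := hτentry 0 0
  have e01 : FormalCoordChange.linMat θ 0 1 = FormalCoordChange.linMat τ 0 1 := hτentry 0 1
  have e10 : FormalCoordChange.linMat θ 1 0 = FormalCoordChange.linMat τ 1 0 := hτentry 1 0
  have e11 : FormalCoordChange.linMat θ 1 1 = FormalCoordChange.linMat τ 1 1 := hτentry 1 1
  have e02 : FormalCoordChange.linMat θ 0 2 = 0 := hcol 0
  have e12 : FormalCoordChange.linMat θ 1 2 = 0 := hcol 1
  have e20 : FormalCoordChange.linMat θ 2 0 = 0 := hrow 0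
  have e21 : FormalCoordChange.linMat θ 2 1 = 0 := hrow 1
  have e22 : FormalCoordChange.linMat θ 2 2 = constantCoeff u := hcorner
  have hdet : (FormalCoordChange.linMat θ).det = (FormalCoordChange.linMat τ).det * constantCoeff u := by
    rw [Matrix.det_fin_three, Matrix.det_fin_two, e00, e01, e10, e11, e02, e12, e20, e21, e22]
    ring
  have hθdet : IsUnit (FormalCoordChange.linMat θ).det := by
    rw [hdet]
    exact hτdet.mul (isUnit_iff_ne_zero.mpr hu)
  refine ⟨θ, rename (Fin.succAboveEmb (Fin.last 2)) (u ^ 2), hθ0, hθdet, ?_, ?_⟩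
  · rw [constantCoeff_rename, map_pow]
    exact pow_ne_zero 2 hu
  · rw [pos, pos, ← coe_substAlgHom hθs]
    simp only [map_add, map_mul, map_pow, coe_substAlgHom, hθren, subst_X hθs, hθlast, h₀, h₁, map_mul, map_pow]
    ring

/-! ## `blowOne ∘ shear (C λ)` as a substitution -/

/-- `u₁^c · blowOne c (shear (C λ) B) = B(u₁, u₁(u₂ + λ))` for `B` with exponents `e₀ + e₁ ≥ c`. -/
theorem X_pow_mul_blowOne_shear_C (cexp : ℕ) (lam : k) (B : MvPowerSeries (Fin 2) k)
    (hB : ∀ e : Fin 2 →₀ ℕ, coeff e B ≠ 0 → cexp ≤ e 0 + e 1) :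
    X 0 ^ cexp * blowOne cexp (shear (C lam) B) = subst ![(X 0 : MvPowerSeries (Fin 2) k), X 0 * (X 1 + C lam)] B := by
  have hB' : ∀ e : Fin 2 →₀ ℕ, coeff e (shear (C lam) B) ≠ 0 → cexp ≤ e 0 + e 1 := by
    intro e he
    by_contra hlt
    push Not at hlt
    apply he
    have hord : (cexp : ℕ∞) ≤ B.order := by
      apply MvPowerSeries.le_order
      intro d hd
      by_contra hne
      have := hB d hne
      have hdeg : Finsupp.degree d = d 0 + d 1 := by rw [Finsupp.degree_eq_sum]; simp [Fin.sum_univ_two]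
      rw [hdeg] at hd
      exact absurd this (not_le.mpr (by exact_mod_cast hd))
    apply coeff_of_lt_order
    rw [shear_eq]
    refine lt_of_lt_of_le ?_ (le_trans hord (FormalShear.order_le_order_subst' _ (constantCoeff_shearFamily _) B))
    have hdeg : Finsupp.degree e = e 0 + e 1 := by rw [Finsupp.degree_eq_sum]; simp [Fin.sum_univ_two]
    rw [hdeg]
    exact_mod_cast hlt
  rw [X_pow_mul_blowOne cexp _ hB', subst_blowFamily_shear_C]

/-! ## Generic: slice data ⇒ re-presentation -/

/-- From `s² T₀ = F₀`, `s T₁ = F₁` and a substitution `τ` with `τ^* F₀ = τ₀² · u² X₀`, `τ^* F₁ = τ₀ · u X₁` (`τ₀ = τ^* s ≠ 0`), the slice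
`pos T₀ T₁` is re-presented by `(X₀, X₁)`. -/
theorem represents_of_sliceData {T₀ T₁ F₀ F₁ X₀ X₁ : MvPowerSeries (Fin 2) k} (τ : Fin 2 → MvPowerSeries (Fin 2) k)
    (u : MvPowerSeries (Fin 2) k) (hτ0 : ∀ i, constantCoeff (τ i) = 0) (hτdet : IsUnit (FormalCoordChange.linMat τ).det)
    (hτne : τ 0 ≠ 0) (hu : constantCoeff u ≠ 0) (hT₀ : X 0 ^ 2 * T₀ = F₀) (hT₁ : X 0 * T₁ = F₁)
    (hF₀ : subst τ F₀ = τ 0 ^ 2 * (u ^ 2 * X₀)) (hF₁ : subst τ F₁ = τ 0 * (u * X₁)) :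
    Represents (pos T₀ T₁) X₀ X₁ := by
  have hs : HasSubst τ := hasSubst_of_constantCoeff_zero hτ0
  refine represents_pos_of_subst τ u hτ0 hτdet hu ?_ ?_
  · apply mul_left_cancel₀ (pow_ne_zero 2 hτne)
    rw [← hF₀, ← hT₀, subst_mul hs, subst_pow hs, subst_X hs]
  · apply mul_left_cancel₀ hτne
    rw [← hF₁, ← hT₁, subst_mul hs, subst_X hs]

/-! ## The restricted chart families of the two moves -/

/-- Point blow-up (weights `(1,1)`), slice `y′₀ = 0` at `c`: `u₁ ↦ c₀ s`, `u₂ ↦ s(c₁ + y′₁)`. -/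
theorem restrictedChart_point_zero (c : Fin 2 → k) :
    (fun l : Fin 2 => X 0 ^ ((fun _ : Fin 2 => (1 : ℕ)) l) *
      (C (c l) + if l = (0 : Fin 2) then (0 : MvPowerSeries (Fin 2) k) else X (Fin.predAbove 0 l.succ))) =
      ![X 0 * C (c 0), X 0 * (C (c 1) + X 1)] := by
  funext l
  fin_cases l
  · show X 0 ^ 1 * (C (c 0) + 0) = X 0 * C (c 0)
    rw [pow_one, add_zero]
  · show X 0 ^ 1 * (C (c 1) + X (Fin.predAbove 0 (Fin.succ 1))) = X 0 * (C (c 1) + X 1)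
    have : Fin.predAbove (0 : Fin 2) (Fin.succ (1 : Fin 2)) = 1 := by decide
    rw [this, pow_one]

/-- Point blow-up, slice `y′₁ = 0` at `c`: `u₁ ↦ s(c₀ + y′₀)`, `u₂ ↦ c₁ s`. -/
theorem restrictedChart_point_one (c : Fin 2 → k) :
    (fun l : Fin 2 => X 0 ^ ((fun _ : Fin 2 => (1 : ℕ)) l) *
      (C (c l) + if l = (1 : Fin 2) then (0 : MvPowerSeries (Fin 2) k) else X (Fin.predAbove 1 l.succ))) =
      ![X 0 * (C (c 0) + X 1), X 0 * C (c 1)] := by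
  funext l
  fin_cases l
  · show X 0 ^ 1 * (C (c 0) + X (Fin.predAbove 1 (Fin.succ 0))) = X 0 * (C (c 0) + X 1)
    have : Fin.predAbove (1 : Fin 2) (Fin.succ (0 : Fin 2)) = 1 := by decide
    rw [this, pow_one]
  · show X 0 ^ 1 * (C (c 1) + 0) = X 0 * C (c 1)
    rw [pow_one, add_zero]

/-- Blow-up of `V(y, u₁)` (weights `(1,0)`), slice at `c₁`: `u₁ ↦ c₁ s`, `u₂ ↦ u₂`. -/
theorem restrictedChart_curve_zero (ci : k) :
    (fun l : Fin 2 => X 0 ^ ((fun l : Fin 2 => if l = (0 : Fin 2) then 1 else 0) l) *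
      (C ((fun l : Fin 2 => if l = (0 : Fin 2) then ci else 0) l) +
        if l = (0 : Fin 2) then (0 : MvPowerSeries (Fin 2) k) else X (Fin.predAbove 0 l.succ))) =
      ![X 0 * C ci, X 1] := by
  funext l
  fin_cases l
  · show X 0 ^ (if (0 : Fin 2) = 0 then 1 else 0) * (C (if (0 : Fin 2) = 0 then ci else 0) + 0) = X 0 * C ci
    rw [if_pos rfl, if_pos rfl, pow_one, add_zero]
  · show X 0 ^ (if (1 : Fin 2) = 0 then 1 else 0) * (C (if (1 : Fin 2) = 0 then ci else 0) +
      X (Fin.predAbove 0 (Fin.succ 1))) = X 1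
    have : Fin.predAbove (0 : Fin 2) (Fin.succ (1 : Fin 2)) = 1 := by decide
    rw [this, if_neg (by decide : (1 : Fin 2) ≠ 0), if_neg (by decide : (1 : Fin 2) ≠ 0), pow_zero, one_mul, map_zero, zero_add]

/-- Blow-up of `V(y, u₂)` (weights `(0,1)`), slice at `c₂`: `u₁ ↦ u₁` (renamed `X 1`), `u₂ ↦ c₂ s`. -/
theorem restrictedChart_curve_one (ci : k) :
    (fun l : Fin 2 => X 0 ^ ((fun l : Fin 2 => if l = (1 : Fin 2) then 1 else 0) l) *
      (C ((fun l : Fin 2 => if l = (1 : Fin 2) then ci else 0) l) +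
        if l = (1 : Fin 2) then (0 : MvPowerSeries (Fin 2) k) else X (Fin.predAbove 1 l.succ))) =
      ![X 1, X 0 * C ci] := by
  funext l
  fin_cases l
  · show X 0 ^ (if (0 : Fin 2) = 1 then 1 else 0) * (C (if (0 : Fin 2) = 1 then ci else 0) +
      X (Fin.predAbove 1 (Fin.succ 0))) = X 1
    have : Fin.predAbove (1 : Fin 2) (Fin.succ (0 : Fin 2)) = 1 := by decide
    rw [this, if_neg (by decide : (0 : Fin 2) ≠ 1), if_neg (by decide : (0 : Fin 2) ≠ 1), pow_zero, one_mul, map_zero, zero_add]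
  · show X 0 ^ (if (1 : Fin 2) = 1 then 1 else 0) * (C (if (1 : Fin 2) = 1 then ci else 0) + 0) = X 0 * C ci
    rw [if_pos rfl, if_pos rfl, pow_one, add_zero]

/-! ## Slice data of the point blow-up -/

/-- The exponent bounds `e₀ + e₁ ≥ 2` on `B₀` and `≥ 1` on `B₁` for a position. -/
theorem sum_ge_of_isPosition {B₀ B₁ : MvPowerSeries (Fin 2) k} (hB : IsPosition B₀ B₁) :
    (∀ e : Fin 2 →₀ ℕ, coeff e B₀ ≠ 0 → 2 ≤ e 0 + e 1) ∧ (∀ e : Fin 2 →₀ ℕ, coeff e B₁ ≠ 0 → 1 ≤ e 0 + e 1) :=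
  ⟨le_sum_of_le_order (c := 2) (by exact_mod_cast hB.1.le), le_sum_of_le_order (c := 1) (by exact_mod_cast hB.2.le)⟩

/-- POINT SLICE DATA: from the factorisations `B_j ∘ chart(c) = s^{3−j} Bv_j` of the clause, the slices `T_j = (s·Bv_j)|_{y′_{i₀}=0}` satisfy
`s^{2−j} · T_j = B_j ∘ (restricted chart)`. -/
theorem pointSlice_data {B₀ B₁ : MvPowerSeries (Fin 2) k} (c : Fin 2 → k) (i₀ : Fin 2) (Bv : Fin 2 → MvPowerSeries (Fin 3) k)
    (hBv : ∀ j : Fin 2, subst (CobordantChart.chart (fun _ : Fin 2 => 1) c) ((![B₀, B₁] : Fin 2 → MvPowerSeries (Fin 2) k) j) =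
      X 0 ^ (2 - (j : ℕ) + 1) * Bv j) :
    X 0 ^ 2 * TupleGame.slice i₀ (X 0 * Bv 0) = subst (fun l : Fin 2 => X 0 ^ ((fun _ : Fin 2 => (1 : ℕ)) l) *
        (C (c l) + if l = i₀ then (0 : MvPowerSeries (Fin 2) k) else X (Fin.predAbove i₀ l.succ))) B₀ ∧
      X 0 * TupleGame.slice i₀ (X 0 * Bv 1) = subst (fun l : Fin 2 => X 0 ^ ((fun _ : Fin 2 => (1 : ℕ)) l) *
        (C (c l) + if l = i₀ then (0 : MvPowerSeries (Fin 2) k) else X (Fin.predAbove i₀ l.succ))) B₁ := by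
  have h0 := SliceChart.subst_restrictedChart (n := 1) (fun _ : Fin 2 => 1) c (fun l h => absurd h one_ne_zero) B₀ 3 (Bv 0)
    (by have := hBv 0; simpa using this) i₀
  have h1 := SliceChart.subst_restrictedChart (n := 1) (fun _ : Fin 2 => 1) c (fun l h => absurd h one_ne_zero) B₁ 2 (Bv 1)
    (by have := hBv 1; simpa using this) i₀
  constructor
  · rw [h0, ← pow_one (X 0 : MvPowerSeries (Fin 3) k), MultiplicityLift.slice_X_zero_pow_mul, pow_one]
    unfold TupleGame.slice
    ring
  · rw [h1, ← pow_one (X 0 : MvPowerSeries (Fin 3) k), MultiplicityLift.slice_X_zero_pow_mul, pow_one]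
    unfold TupleGame.slice
    ring

/-! ## Slice data of the curve blow-ups -/

/-- The curve slice data: `slice_i (A′ ∘ chart) = A′ ∘ (restricted chart)`. -/
theorem curveSlice_data (i : Fin 2) (ci : k) (A : MvPowerSeries (Fin 2) k) :
    TupleGame.slice i (subst (CobordantChart.chart (fun l : Fin 2 => if l = i then 1 else 0)
        (fun l : Fin 2 => if l = i then ci else 0)) A) =
      subst (fun l : Fin 2 => X 0 ^ ((fun l : Fin 2 => if l = i then 1 else 0) l) *
        (C ((fun l : Fin 2 => if l = i then ci else 0) l) + if l = i then (0 : MvPowerSeries (Fin 2) k)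
          else X (Fin.predAbove i l.succ))) A := by
  have h := SliceChart.subst_restrictedChart (n := 1) (fun l : Fin 2 => if l = i then 1 else 0)
    (fun l : Fin 2 => if l = i then ci else 0) (fun l hl => by simp only [ite_eq_right_iff, one_ne_zero, imp_false] at hl; exact if_neg hl)
    A 0 (subst (CobordantChart.chart (fun l : Fin 2 => if l = i then 1 else 0) (fun l : Fin 2 => if l = i then ci else 0)) A)
    (by rw [pow_zero, one_mul]) i
  rw [pow_zero, one_mul] at h
  rw [h]
  rfl


end MonicDescent

end Summit.ResolutionOfSingularities.ResolutionOfSingularities.Theorems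

end
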